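import Summits.MatrixMultiplication.MatrixMultiplication.Theorems.SaturationLadderXPerfectEntropy
import Summits.MatrixMultiplication.MatrixMultiplication.Theorems.SaturationLadderChordLadder

/-!
# The two-parameter X-perfect `CW_q` family (route `SaturationLadder`, lens 1, gen 18) — file 2/2: assembly,
three new exact points, and the `E₂`-chord frontier `0.3465`

Decomposition cell `decomp-mm`, lens 1 (grading / quantitative ladder), generation 18; continues
`Theorems/SaturationLadderXPerfectEntropy.lean` (layers B1/B2 for the joint type `(ma, mb, mc, mb)`,
`a + c = qb`) and `Theorems/SaturationLadderChordLadder.lean` (the `E₂`-chord ladder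
`R_t : ω(1, t, 1+t) = 2 + t`, frontier `0.3386` from the point `T(1/2, 9/2)`).  PROOF, 0 sorry, of

* `omegaRect_xPerfect_le` / `omegaRect_xPerfect_eq`: for integers `q ≥ 2`, `b ≥ 1`, `a + c = qb` satisfying the
  ENTROPY CONDITION `2 η(1/(q+2)) + η(q/(q+2)) ≤ h((a+b)/((q+2)b))` — in integers
  `(a+b)^{a+b} (b+c)^{b+c} ≤ b^{(q+2)b} q^{qb}` — **`ω(a, b, c) = qb = a + c`**: the information bound
  `ω(a,b,c) ≥ a + c` is attained; normalised (`tight_xPerfect`, homogeneity), **`T(b/a, c/a)`**: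
  `ω(1, b/a, c/a) = 1 + c/a`.  The lineage's family `tight_cwFamily (q,k,c)` is the line `a = b + 1`; the
  level-1 X-perfect designs of the literature (Coppersmith–Winograd 1990 §6 "easy" algorithm, Huang–Pan 1998 §4,
  Le Gall 2012 §4.1 first power) are members evaluated for VALUE; here the family is evaluated for EXACTNESS.
* Three members typed: `(q,a,b,c) = (7,3,1,4)` (`4⁴·5⁵ ≤ 7⁷`): **`ω(3,1,4) = 7` unconditionally**
  (`omegaRect_three_one_four`; in `SaturationLadderChordLadder` it needed `α ≥ 0.321334`), i.e. `T(1/3, 4/3)`;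
  `(8,5,2,11)` (`7⁷·13¹³ ≤ 2²⁰·8¹⁶`): **`ω(5,2,11) = 16`**, i.e. `T(2/5, 11/5)`;
  `(8,19,8,45)` (`27²⁷·53⁵³ ≤ 8¹⁴⁴`): **`ω(19,8,45) = 64`**, i.e. `T(8/19, 45/19)` — the member of smallest
  anchored slope `(r−1)/(t−0.321334) = 13.72…` (against `19.59` for `T(1/2, 9/2)`; the family's infimum is
  `13.67…` at `q = 8`, `a/b → 2.3701…`).
* `chordRung_frontier'`: under `α ≥ 0.321334` (VXXZ 2024, named fact) the chord rungs `R_t` hold for every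
  `0 ≤ t ≤ 0.3465` (exact supremum of this anchor-and-one-point method over the whole level-1 X-perfect family:
  `0.34669`); prices at the new top (`chordRung_prices`): `α ≥ 0.2953`, `ω ≤ 2.6139` — still consequence-free.

References: Coppersmith–Winograd 1990 §6 [CoppersmithWinograd1990]; Le Gall, ISSAC 2014, App. A [LeGall2014];
Alman–Duan–Vassilevska Williams–Xu–Xu–Zhou, SODA 2025, Thm. 3.2 [AlmanDuanVassilevskaWilliamsXuXuZhou2025];
Huang–Pan 1998 §2 (2.8), §4 [HuangPan1998]; Le Gall 2012 §4.1 [LeGall2012]; Lotti–Romani 1983 [LottiRomani1983];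
Vassilevska Williams–Xu–Xu–Zhou 2024 [VassilevskaWilliamsXuXuZhou2024].  No new definitions, no named facts, no sorry.
-/

set_option linter.dupNamespace false
-- (single-conjunct summit: the namespace repeats `MatrixMultiplication`)

noncomputable section

open Finset
open scoped BigOperators

namespace Summit.MatrixMultiplication.MatrixMultiplication.Theorems.SaturationLadderXPerfect

open Literature.Computability.AlgebraicComplexity
open Literature.Barriers.MatrixMultiplication
open Summit.MatrixMultiplication.MatrixMultiplication.Theorems.PerfectAmortisation
  (stub_cwRectRestriction)
open Summit.MatrixMultiplication.MatrixMultiplication.Theorems.SaturationLadderExpSaturation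
open Summit.MatrixMultiplication.MatrixMultiplication.Theorems.SaturationLadderChordLadder
  (chordRung_of_anchor chordRung_frontier chordRung_prices)

/-! ## §1 Assembly: `ω(a, b, c) ≤ qb` for the whole two-parameter family -/

/-- **`ω(a, b, c) ≤ qb` whenever `a + c = qb` and the entropy condition holds** — the first-power `CW_q`
laser method with the X-perfect joint type `(a, b, c, b)/((q+2)b)`: for every `δ > 0`,
`|Δ| · (q^m)^{ω(a,b,c)} ≤ R̃(⟨|Δ|⟩ ⊗ ⟨q^{ma}, q^{mb}, q^{mc}⟩) ≤ R̃(CW_q^{⊗(q+2)bm}) ≤ (q+2)^{(q+2)bm}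
≤ |Δ| · (q^m)^{qb+δ}` (the proof of `omegaRect_cwFamily_le` with `k+1 ↦ a`, `k ↦ b`; the threshold
`famThreshold q b` is reused verbatim). [cite: AlmanDuanVassilevskaWilliamsXuXuZhou2025, Thm. 3.2]
[cite: LeGall2014, Appendix A] [cite: CoppersmithWinograd1990, §6] -/
theorem omegaRect_xPerfect_le (q a b c : ℕ) (hq : 2 ≤ q) (hb : 1 ≤ b) (hqb : q * b = a + c)
    (hent : 2 * Real.negMulLog (1 / ((q : ℝ) + 2)) + Real.negMulLog (1 - 2 * (1 / ((q : ℝ) + 2))) ≤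
      Real.binEntropy (((a : ℝ) + b) / (((q : ℝ) + 2) * b))) :
    omegaRect ℂ a b c ≤ (q : ℝ) * b := by
  refine le_of_forall_pos_lt_add fun δ hδ => ?_
  obtain ⟨m, hm, hT⟩ := famThreshold q b hq hb (δ / 2) (half_pos hδ)
  obtain ⟨Δ, hS, hcnt, hfree, hsize⟩ := xpDiagonal q a b c m hq hb hm hqb hent
  have hres := stub_cwRectRestriction q (m * a) (m * b) (m * c) ((q + 2) * b * m) Δ hS hcnt hfree
  have hV : 1 ≤ Δ.card := by
    by_contra h0
    have h0' : Δ.card = 0 := by omega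
    rw [h0', Nat.cast_zero, zero_mul, zero_mul, zero_mul] at hsize
    exact absurd hsize (not_le.2 (Real.exp_pos _))
  have hnum := hT Δ.card hsize
  have hm0 : m ≠ 0 := by omega
  have hqle : q ≤ q ^ m := Nat.le_self_pow hm0 q
  have hq2 : 2 ≤ q ^ m := hq.trans hqle
  -- the general-format asymptotic sum inequality (ADVXXZ 2025, Thm. 3.2) at `q^m`, `(a,b,c)`
  have hasi := advxxz2025_thm32 ℂ hq2 a b c hV
  rw [asymptoticRank_multiple_matMulTensor_congr (pow_mul q m a).symm (pow_mul q m b).symm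
    (pow_mul q m c).symm] at hasi
  push_cast at hasi
  -- `R̃(⟨V⟩ ⊗ ⟨q^{ma}, q^{mb}, q^{mc}⟩) ≤ R̃(CW_q^{⊗N}) ≤ (q+2)^N`
  have h2 := asymptoticRank_le_of_polyDegeneratesTo hres.polyDegeneratesTo
  have hcw : asymptoticRank (bigCwTensor ℂ q) ≤ (q : ℝ) + 2 := by
    exact_mod_cast asymptoticRank_bigCwTensor_le ℂ q
  have hNpos : 0 < (q + 2) * b * m := Nat.mul_pos (Nat.mul_pos (by omega) (by omega)) (by omega)
  have h3 : asymptoticRank (kroneckerPow (bigCwTensor ℂ q) ((q + 2) * b * m)) ≤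
      ((q : ℝ) + 2) ^ ((q + 2) * b * m) :=
    (asymptoticRank_kroneckerPow_le (bigCwTensor ℂ q) hNpos).trans
      (pow_le_pow_left₀ (asymptoticRank_nonneg _) hcw ((q + 2) * b * m))
  have hchain : (Δ.card : ℝ) * ((q : ℝ) ^ m) ^ omegaRect ℂ a b c ≤
      (Δ.card : ℝ) * ((q : ℝ) ^ m) ^ ((q : ℝ) * b + δ / 2) :=
    hasi.trans (h2.trans (h3.trans hnum))
  have hV0 : (0 : ℝ) < Δ.card := by exact_mod_cast hV
  have h4 : ((q : ℝ) ^ m) ^ omegaRect ℂ a b c ≤ ((q : ℝ) ^ m) ^ ((q : ℝ) * b + δ / 2) :=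
    le_of_mul_le_mul_left hchain hV0
  have hq1 : (1 : ℝ) < (q : ℝ) ^ m := by
    have h : ((2 : ℕ) : ℝ) ≤ ((q ^ m : ℕ) : ℝ) := by exact_mod_cast hq2
    push_cast at h
    linarith
  have h5 : omegaRect ℂ a b c ≤ (q : ℝ) * b + δ / 2 :=
    (Real.rpow_le_rpow_left_iff hq1).1 h4
  linarith

/-- **Exactness along the family**: `ω(a, b, c) = qb = a + c` (the information bound `ω(a,b,c) ≥ a + c`,
Huang–Pan 1998 (2.8), is attained). [cite: HuangPan1998, §2 eq. (2.8) (p. 262)]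
[cite: AlmanDuanVassilevskaWilliamsXuXuZhou2025, Thm. 3.2] -/
theorem omegaRect_xPerfect_eq (q a b c : ℕ) (hq : 2 ≤ q) (hb : 1 ≤ b) (hqb : q * b = a + c)
    (hent : 2 * Real.negMulLog (1 / ((q : ℝ) + 2)) + Real.negMulLog (1 - 2 * (1 / ((q : ℝ) + 2))) ≤
      Real.binEntropy (((a : ℝ) + b) / (((q : ℝ) + 2) * b))) :
    omegaRect ℂ a b c = (a : ℝ) + c := by
  have hc' : (q : ℝ) * b = (a : ℝ) + c := by exact_mod_cast hqb
  refine le_antisymm ?_ (add_le_omegaRect₁₃ ℂ a b c)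
  rw [← hc']
  exact omegaRect_xPerfect_le q a b c hq hb hqb hent

/-- **Tightness of the information bound along the family, normalised**: `ω(1, b/a, c/a) ≤ 1 + c/a`
(`ω(a,b,c) = a · ω(1, b/a, c/a)`, homogeneity, Lotti–Romani 1983). [cite: LottiRomani1983, §1 (p. 173)] -/
theorem tight_xPerfect (q a b c : ℕ) (hq : 2 ≤ q) (ha : 1 ≤ a) (hb : 1 ≤ b) (hqb : q * b = a + c)
    (hent : 2 * Real.negMulLog (1 / ((q : ℝ) + 2)) + Real.negMulLog (1 - 2 * (1 / ((q : ℝ) + 2))) ≤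
      Real.binEntropy (((a : ℝ) + b) / (((q : ℝ) + 2) * b))) :
    omegaRect ℂ 1 ((b : ℝ) / a) ((c : ℝ) / a) ≤ 1 + (c : ℝ) / a := by
  have h := omegaRect_xPerfect_le q a b c hq hb hqb hent
  have ha0 : (0 : ℝ) < a := by exact_mod_cast ha
  have hhom := LottiRomani1983_homogeneous ℂ ha0.le zero_le_one
    (by positivity : (0 : ℝ) ≤ (b : ℝ) / a) (by positivity : (0 : ℝ) ≤ (c : ℝ) / a)
  have e : omegaRect ℂ a b c =
      omegaRect ℂ ((a : ℝ) * 1) ((a : ℝ) * ((b : ℝ) / a)) ((a : ℝ) * ((c : ℝ) / a)) := by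
    rw [mul_one, mul_div_cancel₀ _ ha0.ne', mul_div_cancel₀ _ ha0.ne']
  rw [e, hhom] at h
  have hc' : (q : ℝ) * b = (a : ℝ) + c := by exact_mod_cast hqb
  refine le_of_mul_le_mul_left ?_ ha0
  calc (a : ℝ) * omegaRect ℂ 1 ((b : ℝ) / a) ((c : ℝ) / a) ≤ (q : ℝ) * b := h
    _ = (a : ℝ) * (1 + (c : ℝ) / a) := by rw [hc', mul_add, mul_one, mul_div_cancel₀ _ ha0.ne']

/-! ## §2 Three members: `ω(3,1,4) = 7`, `ω(5,2,11) = 16`, `ω(19,8,45) = 64` -/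

/-- The entropy condition at `(q,a,b) = (7,3,1)`: `2η(1/9) + η(7/9) ≤ h(4/9)`, i.e. `4 log 4 + 5 log 5 ≤ 7 log 7`,
i.e. `4⁴·5⁵ = 800000 ≤ 823543 = 7⁷`. [folklore] -/
theorem entropyCondition_7_3_1 :
    2 * Real.negMulLog (1 / (((7 : ℕ) : ℝ) + 2)) + Real.negMulLog (1 - 2 * (1 / (((7 : ℕ) : ℝ) + 2))) ≤
      Real.binEntropy ((((3 : ℕ) : ℝ) + ((1 : ℕ) : ℝ)) / ((((7 : ℕ) : ℝ) + 2) * ((1 : ℕ) : ℝ))) := by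
  have key : 4 * Real.log 4 + 5 * Real.log 5 ≤ 7 * Real.log 7 := by
    have h := Real.log_le_log (by norm_num : (0 : ℝ) < 4 ^ 4 * 5 ^ 5)
      (by norm_num : (4 : ℝ) ^ 4 * 5 ^ 5 ≤ 7 ^ 7)
    rw [Real.log_mul (by norm_num) (by norm_num), Real.log_pow, Real.log_pow, Real.log_pow] at h
    push_cast at h
    linarith
  have e0 : (1 : ℝ) / (((7 : ℕ) : ℝ) + 2) = 1 / 9 := by norm_num
  have e2 : (((3 : ℕ) : ℝ) + ((1 : ℕ) : ℝ)) / ((((7 : ℕ) : ℝ) + 2) * ((1 : ℕ) : ℝ)) = 4 / 9 := by norm_num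
  rw [e0, e2, show (1 : ℝ) - 2 * (1 / 9) = 7 / 9 by norm_num,
    Real.binEntropy_eq_negMulLog_add_negMulLog_one_sub, show (1 : ℝ) - 4 / 9 = 5 / 9 by norm_num]
  simp only [Real.negMulLog]
  rw [Real.log_div (by norm_num) (by norm_num), Real.log_div (by norm_num) (by norm_num),
    Real.log_div (by norm_num) (by norm_num), Real.log_div (by norm_num) (by norm_num), Real.log_one]
  linarith

/-- **`ω(3, 1, 4) = 7` unconditionally: `⟨n³, n, n⁴⟩` is exactly tight** — the member `(7,3,1,4)` (the rung
`R_{1/3} = T(1/3, 4/3)` of the `E₂`-chord ladder, there obtained under `α ≥ 0.321334`).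
[cite: AlmanDuanVassilevskaWilliamsXuXuZhou2025, Thm. 3.2] [cite: HuangPan1998, §2 eq. (2.8) (p. 262)] -/
theorem omegaRect_three_one_four : omegaRect ℂ 3 1 4 = 7 := by
  have h := omegaRect_xPerfect_eq 7 3 1 4 (by norm_num) le_rfl (by norm_num) entropyCondition_7_3_1
  norm_num at h
  exact h

/-- `T(1/3, 4/3)` unconditionally: `ω(1, 1/3, 4/3) ≤ 7/3`. [cite: LottiRomani1983, §1 (p. 173)] -/
theorem tight_third_fourThirds : omegaRect ℂ 1 (1 / 3) (4 / 3) ≤ 1 + 4 / 3 := by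
  have h := tight_xPerfect 7 3 1 4 (by norm_num) (by norm_num) le_rfl (by norm_num) entropyCondition_7_3_1
  have e1 : ((1 : ℕ) : ℝ) / ((3 : ℕ) : ℝ) = 1 / 3 := by norm_num
  have e2 : ((4 : ℕ) : ℝ) / ((3 : ℕ) : ℝ) = 4 / 3 := by norm_num
  rw [e1, e2] at h
  exact h

/-- The entropy condition at `(q,a,b) = (8,5,2)`: `2η(1/10) + η(4/5) ≤ h(7/20)`, i.e.
`7 log 7 + 13 log 13 ≤ 20 log 2 + 16 log 8`, i.e. `7⁷·13¹³ ≤ 2⁶⁸`. [folklore] -/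
theorem entropyCondition_8_5_2 :
    2 * Real.negMulLog (1 / (((8 : ℕ) : ℝ) + 2)) + Real.negMulLog (1 - 2 * (1 / (((8 : ℕ) : ℝ) + 2))) ≤
      Real.binEntropy ((((5 : ℕ) : ℝ) + ((2 : ℕ) : ℝ)) / ((((8 : ℕ) : ℝ) + 2) * ((2 : ℕ) : ℝ))) := by
  have key : 7 * Real.log 7 + 13 * Real.log 13 ≤ 68 * Real.log 2 := by
    have h := Real.log_le_log (by norm_num : (0 : ℝ) < 7 ^ 7 * 13 ^ 13)
      (by norm_num : (7 : ℝ) ^ 7 * 13 ^ 13 ≤ 2 ^ 68)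
    rw [Real.log_mul (by norm_num) (by norm_num), Real.log_pow, Real.log_pow, Real.log_pow] at h
    push_cast at h
    linarith
  have l4 : Real.log 4 = 2 * Real.log 2 := by
    rw [show (4 : ℝ) = 2 ^ 2 by norm_num, Real.log_pow]; push_cast; ring
  have l10 : Real.log 10 = Real.log 2 + Real.log 5 := by
    rw [show (10 : ℝ) = 2 * 5 by norm_num, Real.log_mul (by norm_num) (by norm_num)]
  have l20 : Real.log 20 = 2 * Real.log 2 + Real.log 5 := by
    rw [show (20 : ℝ) = 2 ^ 2 * 5 by norm_num, Real.log_mul (by norm_num) (by norm_num), Real.log_pow]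
    push_cast; ring
  have e0 : (1 : ℝ) / (((8 : ℕ) : ℝ) + 2) = 1 / 10 := by norm_num
  have e2 : (((5 : ℕ) : ℝ) + ((2 : ℕ) : ℝ)) / ((((8 : ℕ) : ℝ) + 2) * ((2 : ℕ) : ℝ)) = 7 / 20 := by norm_num
  rw [e0, e2, show (1 : ℝ) - 2 * (1 / 10) = 4 / 5 by norm_num,
    Real.binEntropy_eq_negMulLog_add_negMulLog_one_sub, show (1 : ℝ) - 7 / 20 = 13 / 20 by norm_num]
  simp only [Real.negMulLog]
  rw [Real.log_div (by norm_num) (by norm_num), Real.log_div (by norm_num) (by norm_num),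
    Real.log_div (by norm_num) (by norm_num), Real.log_div (by norm_num) (by norm_num), Real.log_one]
  have h5 : 0 < Real.log 5 := Real.log_pos (by norm_num)
  linarith

/-- **`ω(5, 2, 11) = 16`: `⟨n⁵, n², n¹¹⟩` is exactly tight** — the member `(8,5,2,11)`, i.e. `T(2/5, 11/5)`.
[cite: AlmanDuanVassilevskaWilliamsXuXuZhou2025, Thm. 3.2] [cite: HuangPan1998, §2 eq. (2.8) (p. 262)] -/
theorem omegaRect_five_two_eleven : omegaRect ℂ 5 2 11 = 16 := by
  have h := omegaRect_xPerfect_eq 8 5 2 11 (by norm_num) (by norm_num) (by norm_num) entropyCondition_8_5_2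
  norm_num at h
  exact h

/-- `T(2/5, 11/5)`: `ω(1, 2/5, 11/5) ≤ 16/5`. [cite: LottiRomani1983, §1 (p. 173)] -/
theorem tight_twoFifths : omegaRect ℂ 1 (2 / 5) (11 / 5) ≤ 1 + 11 / 5 := by
  have h := tight_xPerfect 8 5 2 11 (by norm_num) (by norm_num) (by norm_num) (by norm_num)
    entropyCondition_8_5_2
  have e1 : ((2 : ℕ) : ℝ) / ((5 : ℕ) : ℝ) = 2 / 5 := by norm_num
  have e2 : ((11 : ℕ) : ℝ) / ((5 : ℕ) : ℝ) = 11 / 5 := by norm_num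
  rw [e1, e2] at h
  exact h

/-- The entropy condition at `(q,a,b) = (8,19,8)`: `2η(1/10) + η(4/5) ≤ h(27/80)`, i.e.
`27 log 27 + 53 log 53 ≤ 80 log 8 + 64 log 8 = 144 log 8`, i.e. `27²⁷·53⁵³ ≤ 8¹⁴⁴`. [folklore] -/
theorem entropyCondition_8_19_8 :
    2 * Real.negMulLog (1 / (((8 : ℕ) : ℝ) + 2)) + Real.negMulLog (1 - 2 * (1 / (((8 : ℕ) : ℝ) + 2))) ≤
      Real.binEntropy ((((19 : ℕ) : ℝ) + ((8 : ℕ) : ℝ)) / ((((8 : ℕ) : ℝ) + 2) * ((8 : ℕ) : ℝ))) := by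
  have key : 27 * Real.log 27 + 53 * Real.log 53 ≤ 144 * Real.log 8 := by
    have h := Real.log_le_log (by norm_num : (0 : ℝ) < 27 ^ 27 * 53 ^ 53)
      (by norm_num : (27 : ℝ) ^ 27 * 53 ^ 53 ≤ 8 ^ 144)
    rw [Real.log_mul (by norm_num) (by norm_num), Real.log_pow, Real.log_pow, Real.log_pow] at h
    push_cast at h
    linarith
  have l8 : Real.log 8 = 3 * Real.log 2 := by
    rw [show (8 : ℝ) = 2 ^ 3 by norm_num, Real.log_pow]; push_cast; ring
  have l4 : Real.log 4 = 2 * Real.log 2 := by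
    rw [show (4 : ℝ) = 2 ^ 2 by norm_num, Real.log_pow]; push_cast; ring
  have l10 : Real.log 10 = Real.log 2 + Real.log 5 := by
    rw [show (10 : ℝ) = 2 * 5 by norm_num, Real.log_mul (by norm_num) (by norm_num)]
  have l80 : Real.log 80 = 4 * Real.log 2 + Real.log 5 := by
    rw [show (80 : ℝ) = 2 ^ 4 * 5 by norm_num, Real.log_mul (by norm_num) (by norm_num), Real.log_pow]
    push_cast; ring
  have e0 : (1 : ℝ) / (((8 : ℕ) : ℝ) + 2) = 1 / 10 := by norm_num
  have e2 : (((19 : ℕ) : ℝ) + ((8 : ℕ) : ℝ)) / ((((8 : ℕ) : ℝ) + 2) * ((8 : ℕ) : ℝ)) = 27 / 80 := by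
    norm_num
  rw [e0, e2, show (1 : ℝ) - 2 * (1 / 10) = 4 / 5 by norm_num,
    Real.binEntropy_eq_negMulLog_add_negMulLog_one_sub, show (1 : ℝ) - 27 / 80 = 53 / 80 by norm_num]
  simp only [Real.negMulLog]
  rw [Real.log_div (by norm_num) (by norm_num), Real.log_div (by norm_num) (by norm_num),
    Real.log_div (by norm_num) (by norm_num), Real.log_div (by norm_num) (by norm_num), Real.log_one]
  have h5 : 0 < Real.log 5 := Real.log_pos (by norm_num)
  linarith

/-- **`ω(19, 8, 45) = 64`: `⟨n¹⁹, n⁸, n⁴⁵⟩` is exactly tight** — the member `(8,19,8,45)`, i.e. `T(8/19, 45/19)`,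
the level-1 X-perfect point of (nearly) smallest anchored slope. [cite: AlmanDuanVassilevskaWilliamsXuXuZhou2025, Thm. 3.2]
[cite: HuangPan1998, §2 eq. (2.8) (p. 262)] -/
theorem omegaRect_nineteen_eight_fortyfive : omegaRect ℂ 19 8 45 = 64 := by
  have h := omegaRect_xPerfect_eq 8 19 8 45 (by norm_num) (by norm_num) (by norm_num) entropyCondition_8_19_8
  norm_num at h
  exact h

/-- `T(8/19, 45/19)`: `ω(1, 8/19, 45/19) ≤ 64/19`. [cite: LottiRomani1983, §1 (p. 173)] -/
theorem tight_eight_nineteenths : omegaRect ℂ 1 (8 / 19) (45 / 19) ≤ 1 + 45 / 19 := by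
  have h := tight_xPerfect 8 19 8 45 (by norm_num) (by norm_num) (by norm_num) (by norm_num)
    entropyCondition_8_19_8
  have e1 : ((8 : ℕ) : ℝ) / ((19 : ℕ) : ℝ) = 8 / 19 := by norm_num
  have e2 : ((45 : ℕ) : ℝ) / ((19 : ℕ) : ℝ) = 45 / 19 := by norm_num
  rw [e1, e2] at h
  exact h

/-! ## §3 The `E₂`-chord frontier moves to `0.3465` -/

/-- **FRONTIER (gen 18, second step)**: under `α ≥ 0.321334` the chord rungs `R_t : ω(1,t,1+t) ≤ 2 + t` hold
for every `0 ≤ t ≤ 0.3465` — up to `0.3386` by `chordRung_frontier`, beyond it from the anchor `(0.321334, 1)`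
and the exact point `(8/19, 45/19)` by convexity (anchored slope `13.72…`, exact supremum `0.34659…`).
[cite: VassilevskaWilliamsXuXuZhou2024, Abstract] [cite: LottiRomani1983, §1 (p. 173)] -/
theorem chordRung_frontier' (hα : vxxz2024_alpha_ge) {t : ℝ} (ht0 : 0 ≤ t) (ht : t ≤ 0.3465) :
    omegaRect ℂ 1 t (1 + t) ≤ 2 + t := by
  rcases le_or_gt t 0.3386 with hle | hgt
  · exact chordRung_frontier hα ht0 hle
  · have hanchor : omegaRect ℂ 1 0.321334 1 ≤ 2 := (hα.omegaRect_eq_two le_rfl).le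
    exact chordRung_of_anchor (by norm_num) hanchor (by norm_num : (0.321334 : ℝ) < 8 / 19) (by norm_num)
      tight_eight_nineteenths (by linarith) (by linarith) (by linarith)

/-- **Still consequence-free**: at the new top `t = 0.3465` the `α`-price `2t/(2+t) = 0.2953…` is below the
record `0.321334` and the `ω`-price `3(2+t)/(2+2t) = 2.6139…` far above `2.371552`.
[cite: VassilevskaWilliamsXuXuZhou2024, Abstract] -/
theorem prices_newTop_consequenceFree :
    2 * (0.3465 : ℝ) / (2 + 0.3465) < 0.321334 ∧ (2.371552 : ℝ) < 3 * (2 + 0.3465) / (2 + 2 * 0.3465) := by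
  constructor <;> norm_num

/-- The next candidate grade: `R_{0.35}` would follow from ONE exact point `T(t₂, r₂)` with `t₂ > 0.35` and
anchored slope `(r₂ − 1)/(t₂ − 0.321334) ≤ 0.35/(0.35 − 0.321334) = 12.2…` — e.g. `T(0.45, 2.57)`; the level-1
X-perfect family stops at slope `13.67…`. (The general statement: `chordRung_of_anchor`.)
[cite: LottiRomani1983, §1 (p. 173)] [cite: VassilevskaWilliamsXuXuZhou2024, Abstract] -/
theorem chordRung_pointThirtyFive_of_point (hα : vxxz2024_alpha_ge) {t₂ r₂ : ℝ} (ht₂ : 0.35 ≤ t₂) (hr₂ : 1 ≤ r₂)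
    (h₂ : omegaRect ℂ 1 t₂ r₂ ≤ 1 + r₂) (hslope : (r₂ - 1) * (0.35 - 0.321334) ≤ 0.35 * (t₂ - 0.321334)) :
    omegaRect ℂ 1 0.35 1.35 ≤ 2.35 := by
  have hanchor : omegaRect ℂ 1 0.321334 1 ≤ 2 := (hα.omegaRect_eq_two le_rfl).le
  have h := chordRung_of_anchor (by norm_num) hanchor (by linarith : (0.321334 : ℝ) < t₂) hr₂ h₂
    (by norm_num : (0.321334 : ℝ) ≤ 0.35) ht₂ hslope
  norm_num at h ⊢
  exact h

end Summit.MatrixMultiplication.MatrixMultiplication.Theorems.SaturationLadderXPerfect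

end
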